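import Summits.AtomisticToContinuum.HydrodynamicLimit.Theses.CollisionIsometryCLT
import Literature.MathematicalPhysics.KineticTheory.HardSphereEulerProofs
import Literature.Analysis.FunctionSpaces.TorusMollifier

/-!
# `AprioriBounds` (stmt-AtomisticToContinuum-9519), negative knowledge 2/4: an admissible kernel family exists

Load-bearing analysis of the crux `CollisionIsometryCLT.AprioriBounds` by the standing disprover
(`Cruxes/AprioriBounds/Disproof.lean`, refuter-cdisprove-stmt-AtomisticToContinuum-9519-0).

Component (ii) of the crux (like `FastMomentRelaxation` and `CollisionalTransferLocality`) is
quantified over ADMISSIBLE KERNEL FAMILIES `φ : ℕ → 𝕋³ → ℝ`: `Torus.IsSmooth (φ N)`, `φ N ≥ 0`,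
`∫ φ N = 1`, `φ N y = 0` once `(N+1)^{-γ} ≤ euclidDist y 0`, `φ N ≤ C(N+1)^{3γ}`,
`‖Torus.gradient (φ N)‖ ≤ C(N+1)^{4γ}`, `0 < γ ≤ 1/15`.  To REFUTE such a statement one kernel family
must be exhibited; this file does it once and for all (`exists_admissibleKernelFamily`), with the
tree's torus mollifier `Literature.Analysis.FunctionSpaces.Torus.kernel ε` (transplant of the
normalised bump `ρ_ε = ε⁻³ρ₁(·/ε)`) at `ε_N = (N+1)^{-1/15}/4`: the factor `1/4` keeps `ε_N ≤ 1/4` (the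
mollifier API) and absorbs `euclidDist y 0 ≤ 4‖y‖` (`euclidDist_zero_le_four_mul_norm`); the sup and
gradient bounds are `ε⁻³ sup ρ₁` and `ε⁻⁴ sup ‖Dρ₁‖` (`Torus.fderiv_profile`).
-/

noncomputable section

open MeasureTheory Filter Set Topology
open scoped ENNReal

namespace Summit.AtomisticToContinuum.HydrodynamicLimit.Theorems

namespace AprioriBoundsNegative

open Literature.MathematicalPhysics.KineticTheory Literature.Analysis.FluidPDE

/-- The Euclidean minimal-image distance to `0` is at most `4 ×` the (sup) quotient norm of `𝕋³`
(`√3 ≤ 4`). -/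
theorem euclidDist_zero_le_four_mul_norm (y : T3) : Torus.euclidDist y 0 ≤ 4 * ‖y‖ := by
  rw [euclidDist_eq_sqrt]
  have h : ∑ i, ‖y i - (0 : T3) i‖ ^ 2 ≤ (4 * ‖y‖) ^ 2 := by
    have hi : ∀ i, ‖y i - (0 : T3) i‖ ^ 2 ≤ ‖y‖ ^ 2 := fun i => by
      rw [Pi.zero_apply, sub_zero]
      exact pow_le_pow_left₀ (norm_nonneg _) (norm_le_pi_norm y i) 2
    calc ∑ i, ‖y i - (0 : T3) i‖ ^ 2 ≤ ∑ _i : Fin 3, ‖y‖ ^ 2 := Finset.sum_le_sum fun i _ => hi i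
      _ = 3 * ‖y‖ ^ 2 := by simp
      _ ≤ (4 * ‖y‖) ^ 2 := by nlinarith [norm_nonneg y]
  calc Real.sqrt (∑ i, ‖y i - (0 : T3) i‖ ^ 2) ≤ Real.sqrt ((4 * ‖y‖) ^ 2) := Real.sqrt_le_sqrt h
    _ = 4 * ‖y‖ := Real.sqrt_sq (by positivity)

/-- The kernel radius used below, `ε_N = (N+1)^{-γ}/4`, is positive. -/
theorem kernelRadius_pos (γ : ℝ) (N : ℕ) : 0 < ((N : ℝ) + 1) ^ (-γ) / 4 := by positivity

/-- … and at most `1/4`, so the torus-mollifier API (`0 < ε ≤ 1/4`) applies. -/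
theorem kernelRadius_le (γ : ℝ) (hγ : 0 ≤ γ) (N : ℕ) : ((N : ℝ) + 1) ^ (-γ) / 4 ≤ 1 / 4 := by
  have h1 : (1 : ℝ) ≤ (N : ℝ) + 1 := by simp
  have : ((N : ℝ) + 1) ^ (-γ) ≤ 1 := Real.rpow_le_one_of_one_le_of_nonpos h1 (by linarith)
  linarith

/-- **An admissible kernel family exists**: the tree's standard torus mollifier `Torus.kernel` at
radius `(N+1)^{-1/15}/4` satisfies every admissibility clause of the crux with `γ = 1/15` — smooth,
`≥ 0`, unit mass, vanishing where `(N+1)^{-γ} ≤ euclidDist y 0`, sup `≤ C(N+1)^{3γ}`, gradient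
`≤ C(N+1)^{4γ}` (`C = 256 · max(sup ρ₁, sup ‖Dρ₁‖)`) — and is integrable.  Reusable witness for every
statement of this sub-problem that quantifies over admissible kernel families
(`FastMomentRelaxation`, `CollisionalTransferLocality`, `AprioriBounds` (ii), …). -/
theorem exists_admissibleKernelFamily :
    ∃ (γ C : ℝ) (φ : ℕ → T3 → ℝ), 0 < γ ∧ γ ≤ 1 / 15 ∧
    (∀ N, Literature.Analysis.FunctionSpaces.Torus.IsSmooth (φ N)) ∧ (∀ N y, 0 ≤ φ N y) ∧
    (∀ N, ∫ y, φ N y = 1) ∧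
    (∀ (N : ℕ) y, ((N : ℝ) + 1) ^ (-γ) ≤ Torus.euclidDist y 0 → φ N y = 0) ∧
    (∀ (N : ℕ) y, φ N y ≤ C * ((N : ℝ) + 1) ^ (3 * γ)) ∧
    (∀ (N : ℕ) y, ‖Literature.Analysis.FunctionSpaces.Torus.gradient (φ N) y‖ ≤
      C * ((N : ℝ) + 1) ^ (4 * γ)) ∧
    (∀ N, Integrable (φ N)) := by
  classical
  set γ : ℝ := 1 / 15 with hγ
  set ε : ℕ → ℝ := fun N => ((N : ℝ) + 1) ^ (-γ) / 4 with hεdef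
  have hε0 : ∀ N, 0 < ε N := fun N => kernelRadius_pos γ N
  have hε4 : ∀ N, ε N ≤ 1 / 4 := fun N => kernelRadius_le γ (by norm_num) N
  -- sup bounds of the fixed profile and of its derivative
  obtain ⟨K0, hK0⟩ := (Literature.Analysis.FunctionSpaces.Torus.contDiff_profileOne (d := Fin 3)).continuous.bounded_above_of_compact_support
    (Literature.Analysis.FunctionSpaces.Torus.hasCompactSupport_profileOne (d := Fin 3))
  obtain ⟨K1, hK1⟩ := (Literature.Analysis.FunctionSpaces.Torus.continuous_fderiv_profileOne (d := Fin 3)).bounded_above_of_compact_support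
    ((Literature.Analysis.FunctionSpaces.Torus.hasCompactSupport_profileOne (d := Fin 3)).fderiv (𝕜 := ℝ))
  set K : ℝ := max (max K0 K1) 0 with hK
  have hK0' : K0 ≤ K := (le_max_left _ _).trans (le_max_left _ _)
  have hK1' : K1 ≤ K := (le_max_right _ _).trans (le_max_left _ _)
  have hKnn : 0 ≤ K := le_max_right _ _
  -- powers of the radius
  have hεpow : ∀ (N k : ℕ), ((ε N) ^ k)⁻¹ = 4 ^ k * ((N : ℝ) + 1) ^ ((k : ℝ) * γ) := by
    intro N k
    have hb : 0 ≤ (N : ℝ) + 1 := by positivity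
    have : ε N = (((N : ℝ) + 1) ^ γ)⁻¹ / 4 := by
      rw [hεdef]; simp only [Real.rpow_neg hb]
    rw [this, div_pow, inv_pow, ← Real.rpow_mul_natCast hb, mul_comm γ, inv_div, div_eq_mul_inv,
      inv_inv, mul_comm]
  refine ⟨γ, 256 * K, fun N => Literature.Analysis.FunctionSpaces.Torus.kernel (ε N), by norm_num [hγ],
    le_rfl, fun N => Literature.Analysis.FunctionSpaces.Torus.isSmooth_kernel (hε0 N) (hε4 N),
    fun N y => Literature.Analysis.FunctionSpaces.Torus.kernel_nonneg (hε0 N).le y,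
    fun N => Literature.Analysis.FunctionSpaces.Torus.integral_kernel (hε0 N) (hε4 N),
    fun N y hy => ?_, fun N y => ?_, fun N y => ?_,
    fun N => (Literature.Analysis.FunctionSpaces.Torus.continuous_kernel (hε0 N) (hε4 N)).integrable_unitAddTorus⟩
  · -- support
    refine Literature.Analysis.FunctionSpaces.Torus.kernel_eq_zero_of_le (hε0 N) ?_
    have h4 := euclidDist_zero_le_four_mul_norm y
    show ((N : ℝ) + 1) ^ (-γ) / 4 ≤ ‖y‖
    linarith
  · -- sup bound
    show Literature.Analysis.FunctionSpaces.Torus.transplant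
      (Literature.Analysis.FunctionSpaces.Torus.profile (ε N)) y ≤ 256 * K * ((N : ℝ) + 1) ^ (3 * γ)
    rw [Literature.Analysis.FunctionSpaces.Torus.transplant_apply]
    simp only [Literature.Analysis.FunctionSpaces.Torus.profile, Fintype.card_fin]
    have h3 := hεpow N 3
    push_cast at h3
    rw [h3]
    have hr : 0 ≤ ((N : ℝ) + 1) ^ (3 * γ) := by positivity
    have hp0 : 0 ≤ Literature.Analysis.FunctionSpaces.Torus.profileOne (Fin 3)
        ((ε N)⁻¹ • Literature.Analysis.FunctionSpaces.Torus.reprc y) :=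
      Literature.Analysis.FunctionSpaces.Torus.profileOne_nonneg _
    calc (4 : ℝ) ^ 3 * ((N : ℝ) + 1) ^ (3 * γ) *
          Literature.Analysis.FunctionSpaces.Torus.profileOne (Fin 3)
            ((ε N)⁻¹ • Literature.Analysis.FunctionSpaces.Torus.reprc y)
        ≤ (4 : ℝ) ^ 3 * ((N : ℝ) + 1) ^ (3 * γ) * K :=
          mul_le_mul_of_nonneg_left ((Real.le_norm_self _).trans ((hK0 _).trans hK0')) (by positivity)
      _ ≤ 256 * K * ((N : ℝ) + 1) ^ (3 * γ) := by nlinarith [mul_nonneg hKnn hr]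
  · -- gradient bound
    rw [Literature.Analysis.FunctionSpaces.Torus.norm_gradient_kernel (hε0 N) (hε4 N),
      Literature.Analysis.FunctionSpaces.Torus.fderiv_profile, norm_smul, Fintype.card_fin,
      Real.norm_eq_abs, abs_of_pos (mul_pos (inv_pos.2 (pow_pos (hε0 N) 3)) (inv_pos.2 (hε0 N)))]
    have h4 : ((ε N) ^ 3)⁻¹ * (ε N)⁻¹ = 4 ^ 4 * ((N : ℝ) + 1) ^ (4 * γ) := by
      have h4' := hεpow N 4
      push_cast at h4'
      rw [← h4', ← mul_inv, ← pow_succ]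
    rw [h4]
    have hr : 0 ≤ ((N : ℝ) + 1) ^ (4 * γ) := by positivity
    calc (4 : ℝ) ^ 4 * ((N : ℝ) + 1) ^ (4 * γ) *
          ‖fderiv ℝ (Literature.Analysis.FunctionSpaces.Torus.profileOne (Fin 3))
            ((ε N)⁻¹ • Literature.Analysis.FunctionSpaces.Torus.reprc y)‖
        ≤ (4 : ℝ) ^ 4 * ((N : ℝ) + 1) ^ (4 * γ) * K :=
          mul_le_mul_of_nonneg_left ((hK1 _).trans hK1') (by positivity)
      _ = 256 * K * ((N : ℝ) + 1) ^ (4 * γ) := by ring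

end AprioriBoundsNegative

end Summit.AtomisticToContinuum.HydrodynamicLimit.Theorems

end
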